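import Mathlib
import HarnessLib

/-!
# Inserting the fibre numbers into the eight-fibre-factor split (scalar algebra)

Support file for the crux `NearFlatRatioLaw` (line `ratepack_v2`, stub `stub_hODpot_A`; successor steps (A)–(C) of
`Cruxes/NearFlatRatioLaw/Lines/ratepack-v7-moments-g18.md` §14; memo v8 (g19)).

★ `split_rhs_bound` — in the right side of `…SlowSideFibreFactors.integral_outputWeight_mul_slow_side_le_fibre_factors`,
`[(40(1+η)(a₀₀F₀₀ + a₀₂F₀₂ + a₀₄F₀₄ + a₁(F₁+F₂) + a₃(F₃+F₄)) + 4η²c_q a₀'ℓ²·F_E)‖φ‖² + 40(1+η)(p₀₀F₀₀ + p₀₂F₀₂ + p₁(F₁+F₂))∫od²φ²]/K₁²`,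
replace each fibre factor by its reference-mass bound `F_{a;k,j} ≤ β^{-(a+k+j)}·Ξ·𝓡'` (`…RecordFibreFactor`), `F_E ≤ M₂`, the reference mass by
`𝓡' ≤ Cr·(btC·K₁)` (`…RecordReferenceMassRatio`) and the two gain-weighted coefficient sums by `C_φ·ℓ²·w`, `C_ψ·ℓ²`
(`…CoreDefectPotBookkeeping.slow_coeff_bound_phi/psi`):  the result is the hypothesis `hS` of `…CoreCurrencyPot.core_currency_pot`,
`≤ [40(1+η)ΞCr·(btC·K₁)·ℓ²·(C_φw·‖φ‖² + C_ψ·∫od²φ²) + 4η²(c_q a₀')M₂ℓ²‖φ‖²]/K₁²`.  Pure real algebra (monotonicity).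
-/

noncomputable section

namespace Summit.QuantumFields.YangMills.Theorems.FemtoTransferGap.TwoLattice.ConstTube

/-- ★ **Fibre numbers into the split** (see the module docstring). [folklore] -/
theorem split_rhs_bound {A00 A02 A04 A1 A3 P00 P02 P1 F00 F02 F04 F1 F2 F3 F4 FE Ξ R' R Cr M2 g2 g4 Cφ Cψ ℓ w φ2 ψ2 η cq a0 K : ℝ}
    (hA00 : 0 ≤ A00) (hA02 : 0 ≤ A02) (hA04 : 0 ≤ A04) (hA1 : 0 ≤ A1) (hA3 : 0 ≤ A3) (hP00 : 0 ≤ P00) (hP02 : 0 ≤ P02) (hP1 : 0 ≤ P1)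
    (hφ2 : 0 ≤ φ2) (hψ2 : 0 ≤ ψ2) (hη : 0 ≤ η) (hcq : 0 ≤ cq) (ha0 : 0 ≤ a0) (hΞ : 0 ≤ Ξ) (hR' : 0 ≤ R') (hℓ : 0 ≤ ℓ) (hw : 0 ≤ w) (hCφ : 0 ≤ Cφ) (hCψ : 0 ≤ Cψ)
    (hF00 : F00 ≤ Ξ * R') (hF02 : F02 ≤ g2 * Ξ * R') (hF04 : F04 ≤ g4 * Ξ * R') (hF1 : F1 ≤ g2 * Ξ * R') (hF2 : F2 ≤ g2 * Ξ * R')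
    (hF3 : F3 ≤ g4 * Ξ * R') (hF4 : F4 ≤ g4 * Ξ * R') (hFE : FE ≤ M2) (hRR : R' ≤ Cr * R)
    (hΦ : A00 + A02 * g2 + A04 * g4 + 2 * A1 * g2 + 2 * A3 * g4 ≤ Cφ * ℓ ^ 2 * w) (hΨ : P00 + P02 * g2 + 2 * P1 * g2 ≤ Cψ * ℓ ^ 2) :
    ((40 * (1 + η) * (A00 * F00 + A02 * F02 + A04 * F04 + A1 * (F1 + F2) + A3 * (F3 + F4)) + 4 * η ^ 2 * cq * a0 * ℓ * ℓ * FE) * φ2 +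
          40 * (1 + η) * (P00 * F00 + P02 * F02 + P1 * (F1 + F2)) * ψ2) / K ^ 2 ≤
      (40 * (1 + η) * Ξ * Cr * R * ℓ ^ 2 * (Cφ * w * φ2 + Cψ * ψ2) + 4 * η ^ 2 * (cq * a0) * M2 * ℓ ^ 2 * φ2) / K ^ 2 := by
  refine div_le_div_of_nonneg_right ?_ (sq_nonneg K)
  have hΞR : 0 ≤ Ξ * R' := mul_nonneg hΞ hR'
  -- step 1: replace the fibre factors
  have s1 : A00 * F00 + A02 * F02 + A04 * F04 + A1 * (F1 + F2) + A3 * (F3 + F4) ≤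
      (A00 + A02 * g2 + A04 * g4 + 2 * A1 * g2 + 2 * A3 * g4) * (Ξ * R') := by
    have i0 := mul_le_mul_of_nonneg_left hF00 hA00
    have i2 := mul_le_mul_of_nonneg_left hF02 hA02
    have i4 := mul_le_mul_of_nonneg_left hF04 hA04
    have i1 := mul_le_mul_of_nonneg_left (add_le_add hF1 hF2) hA1
    have i3 := mul_le_mul_of_nonneg_left (add_le_add hF3 hF4) hA3
    have e : (A00 + A02 * g2 + A04 * g4 + 2 * A1 * g2 + 2 * A3 * g4) * (Ξ * R') =
        A00 * (Ξ * R') + A02 * (g2 * Ξ * R') + A04 * (g4 * Ξ * R') + A1 * (g2 * Ξ * R' + g2 * Ξ * R') + A3 * (g4 * Ξ * R' + g4 * Ξ * R') := by ring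
    rw [e]; linarith
  have s1' : P00 * F00 + P02 * F02 + P1 * (F1 + F2) ≤ (P00 + P02 * g2 + 2 * P1 * g2) * (Ξ * R') := by
    have i0 := mul_le_mul_of_nonneg_left hF00 hP00
    have i2 := mul_le_mul_of_nonneg_left hF02 hP02
    have i1 := mul_le_mul_of_nonneg_left (add_le_add hF1 hF2) hP1
    have e : (P00 + P02 * g2 + 2 * P1 * g2) * (Ξ * R') = P00 * (Ξ * R') + P02 * (g2 * Ξ * R') + P1 * (g2 * Ξ * R' + g2 * Ξ * R') := by ring
    rw [e]; linarith
  -- step 2: the coefficient sums and the reference mass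
  have s2 : (A00 + A02 * g2 + A04 * g4 + 2 * A1 * g2 + 2 * A3 * g4) * (Ξ * R') ≤ Cφ * ℓ ^ 2 * w * (Ξ * (Cr * R)) := by
    have h1 := mul_le_mul_of_nonneg_right hΦ hΞR
    have h2 : Cφ * ℓ ^ 2 * w * (Ξ * R') ≤ Cφ * ℓ ^ 2 * w * (Ξ * (Cr * R)) :=
      mul_le_mul_of_nonneg_left (mul_le_mul_of_nonneg_left hRR hΞ) (by positivity)
    exact h1.trans h2
  have s2' : (P00 + P02 * g2 + 2 * P1 * g2) * (Ξ * R') ≤ Cψ * ℓ ^ 2 * (Ξ * (Cr * R)) := by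
    have h1 := mul_le_mul_of_nonneg_right hΨ hΞR
    have h2 : Cψ * ℓ ^ 2 * (Ξ * R') ≤ Cψ * ℓ ^ 2 * (Ξ * (Cr * R)) :=
      mul_le_mul_of_nonneg_left (mul_le_mul_of_nonneg_left hRR hΞ) (by positivity)
    exact h1.trans h2
  have sE : 4 * η ^ 2 * cq * a0 * ℓ * ℓ * FE ≤ 4 * η ^ 2 * cq * a0 * ℓ * ℓ * M2 := mul_le_mul_of_nonneg_left hFE (by positivity)
  -- step 3: assemble
  have h40 : 0 ≤ 40 * (1 + η) := by positivity
  have t1 := mul_le_mul_of_nonneg_left (s1.trans s2) h40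
  have t2 := mul_le_mul_of_nonneg_left (s1'.trans s2') h40
  have u1 := mul_le_mul_of_nonneg_right (add_le_add t1 sE) hφ2
  have u2 := mul_le_mul_of_nonneg_right t2 hψ2
  have e : 40 * (1 + η) * Ξ * Cr * R * ℓ ^ 2 * (Cφ * w * φ2 + Cψ * ψ2) + 4 * η ^ 2 * (cq * a0) * M2 * ℓ ^ 2 * φ2 =
      (40 * (1 + η) * (Cφ * ℓ ^ 2 * w * (Ξ * (Cr * R))) + 4 * η ^ 2 * cq * a0 * ℓ * ℓ * M2) * φ2 + 40 * (1 + η) * (Cψ * ℓ ^ 2 * (Ξ * (Cr * R))) * ψ2 := by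
    ring
  rw [e]; linarith

end Summit.QuantumFields.YangMills.Theorems.FemtoTransferGap.TwoLattice.ConstTube

end
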